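import Mathlib
import Summits.NavierStokesRegularity.NavierStokesRegularity.Theses.ExtremalTypeIConstant
import Summits.NavierStokesRegularity.NavierStokesRegularity.Theorems.TypeIQuarterGateTypeIClockLiouvilleLinks
import Summits.NavierStokesRegularity.NavierStokesRegularity.Theorems.TypeIQuarterGateQuarterZoomEnstrophyClock
import Summits.NavierStokesRegularity.NavierStokesRegularity.Theorems.GaldiLiouvilleGateParabolicGaldiLiouvilleStubOseenMildOfL6
import Summits.NavierStokesRegularity.NavierStokesRegularity.Theorems.GaldiLiouvilleGateParabolicGaldiLiouvilleStubSobolevSixFrobenius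
import Literature.Analysis.FluidPDE.MildAncientTimeDecayRegularity
import HarnessLib

/-!
# `TypeIQuarterGate`: the re-typed residuals TQAL / LRL sit BELOW the Type-I ancient Liouville
# target `ExtremalTypeIConstant.TypeIAncientLiouville` (item stmt-NavierStokesRegularity-4050)

Helper file for crux `ParabolicGaldiLiouville` (stmt-NavierStokesRegularity-0893) of route
`TypeIQuarterGate` (theorems only, no definitions). The TARGET of route `ExtremalTypeIConstant`,
`TypeIAncientLiouville` (item 4050: every smooth, divergence-free, KNSS-gauge Oseen-mild field on
`(−∞,0) × ℝ³` with the Type-I rate `‖u(t,x)‖ ≤ C/√(−t)` vanishes — the Liouville form of Type-I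
exclusion, KNSS 2009 §6 / Seregin–Šverák 2009), implies the re-typed residuals of THIS route:
TQAL (X2 ⟨0893⟩ + the clock `√(−s)‖v(s,y)‖ ≤ C'`) and LRL (TQAL + the enstrophy clock). Mechanism:
a field of the TQAL class is Oseen-mild in the heat-extension form
(`ParabolicGaldiLiouville.Birth.stub_oseenMildOfL6`, the uniform `L⁶` bound coming from
`stub_sobolevSixFrobenius`), has weakly divergence-free continuous slices, and the clock is the
Type-I rate `HasTypeITimeDecay C'`; the tree's `isTypeIAncientMild_of_hasTypeITimeDecay` (KNSS
Prop. 4.1 smoothing in the gauge) puts it in the class `IsTypeIAncientMild C'`, which is item 4050's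
hypothesis verbatim (`isTypeIAncientMild_iff`).

* `typeIClockLiouville_of_typeIAncientLiouville` — item 4050 ⟹ TQAL.
* `lerayRateLiouville_of_typeIAncientLiouville` — item 4050 ⟹ LRL.
* `typeIQuarterGate_of_typeIAncientLiouville` — `QuarterLawTypeI → NoTypeII →
  ExtremalTypeIConstant.TypeIAncientLiouville → NavierStokesRegularity`, by name.

So the residual of route `TypeIQuarterGate` is implied by EITHER of two independent open items of the
tree: X2 = 0893 (Galdi side) and 4050 (Type-I side), and it is weaker than both (it needs the
Liouville theorem only for Type-I-clocked flows INSIDE Galdi's parabolic class). HONEST FRAMING: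
implications between OPEN statements; nothing here bears on Navier–Stokes regularity.
References: Koch–Nadirashvili–Seregin–Šverák, Acta Math. 203 (2009), §1, Prop. 4.1, §6.
-/

noncomputable section

set_option linter.dupNamespace false

namespace Summit.NavierStokesRegularity.NavierStokesRegularity.Theorems

open Set MeasureTheory Filter Topology Function
open scoped ENNReal NNReal
open Literature.Analysis.FluidPDE

namespace QuarterZoomTypeIClock

/-- **The TQAL class lies in the KNSS-gauge Type-I class.** A bounded ancient mild solution (`ν = 1`),
smooth on `(−∞,0) × ℝ³`, with bounded slice enstrophy, `L⁶` slices and the clock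
`√(−s)‖v(s,y)‖ ≤ C'` satisfies `IsTypeIAncientMild C' v` (smooth, divergence-free, Oseen-mild in the
gauge, Type-I rate). [cite: KochNadirashviliSereginSverak2009, Lemma 3.1 and Prop. 4.1] -/
theorem isTypeIAncientMild_of_typeIClock
    {v : ℝ → EuclideanSpace ℝ (Fin 3) → EuclideanSpace ℝ (Fin 3)}
    (hv : IsBoundedAncientMildSolution 1 v)
    (hsm : ContDiffOn ℝ (⊤ : ℕ∞) (Function.uncurry v) (Set.Iio 0 ×ˢ Set.univ))
    (hens : ∃ C : NNReal, ∀ s < 0,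
      ∫⁻ y, ENNReal.ofReal (frobeniusNormSq (fderiv ℝ (v s) y)) ≤ C)
    (hL6 : ∀ s < 0, MemLp (v s) 6 volume)
    {C' : ℝ} (hclock : ∀ s < 0, ∀ y, Real.sqrt (-s) * ‖v s y‖ ≤ C') :
    IsTypeIAncientMild C' v := by
  -- the uniform `L⁶` bound of the slices (Sobolev on `C¹` slices with bounded enstrophy)
  have hslice : ∀ s < 0, ContDiff ℝ 1 (v s) := fun s hs => by
    have h : ContDiff ℝ (⊤ : ℕ∞) (uncurry v ∘ fun y : EuclideanSpace ℝ (Fin 3) => (s, y)) :=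
      hsm.comp_contDiff (contDiff_const.prodMk contDiff_id) fun y => ⟨hs, Set.mem_univ y⟩
    exact h.of_le (by exact_mod_cast le_top)
  obtain ⟨KS, hKS⟩ := ParabolicGaldiLiouville.Birth.stub_sobolevSixFrobenius
  obtain ⟨C, hC⟩ := hens
  have hfin : (KS : ℝ≥0∞) * (C : ℝ≥0∞) ^ (1 / 2 : ℝ) ≠ ⊤ :=
    ENNReal.mul_ne_top ENNReal.coe_ne_top
      (ENNReal.rpow_ne_top_of_nonneg (by norm_num) ENNReal.coe_ne_top)
  have hK6 : ∃ K : NNReal, ∀ s < 0, eLpNorm (v s) 6 volume ≤ K := by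
    refine ⟨((KS : ℝ≥0∞) * (C : ℝ≥0∞) ^ (1 / 2 : ℝ)).toNNReal, fun s hs => ?_⟩
    rw [ENNReal.coe_toNNReal hfin]
    exact (hKS (v s) (hslice s hs) (hL6 s hs)).trans
      (mul_le_mul' le_rfl (ENNReal.rpow_le_rpow (hC s hs) (by norm_num)))
  -- Oseen-mild in the heat-extension form, Type-I rate, weakly divergence-free slices
  have hoseen := ParabolicGaldiLiouville.Birth.stub_oseenMildOfL6 v hv hsm.continuousOn hK6
  have hdec : HasTypeITimeDecay C' v := fun t ht x => by
    have hst : 0 < Real.sqrt (-t) := Real.sqrt_pos.2 (neg_pos.2 ht)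
    rw [le_div_iff₀ hst, mul_comm]
    exact hclock t ht x
  exact isTypeIAncientMild_of_hasTypeITimeDecay hdec hsm.continuousOn hoseen (fun t ht => hv.1.1 t ht)

end QuarterZoomTypeIClock

open QuarterZoomTypeIClock

/-- **Item 4050 ⟹ TQAL.** The target `ExtremalTypeIConstant.TypeIAncientLiouville`
(stmt-NavierStokesRegularity-4050: Type-I ancient Liouville in the KNSS gauge) implies the
Type-I-clock Liouville statement in Galdi's parabolic class (`isTypeIAncientMild_of_typeIClock` and
`isTypeIAncientMild_iff`). [cite: KochNadirashviliSereginSverak2009, §1 and §6] -/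
theorem typeIClockLiouville_of_typeIAncientLiouville
    (hA : Summit.NavierStokesRegularity.NavierStokesRegularity.Theses.ExtremalTypeIConstant.TypeIAncientLiouville) :
    ∀ v : ℝ → EuclideanSpace ℝ (Fin 3) → EuclideanSpace ℝ (Fin 3),
      IsBoundedAncientMildSolution 1 v →
      ContDiffOn ℝ (⊤ : ℕ∞) (Function.uncurry v) (Set.Iio 0 ×ˢ Set.univ) →
      (∃ C : NNReal, ∀ s < 0,
        ∫⁻ y, ENNReal.ofReal (frobeniusNormSq (fderiv ℝ (v s) y)) ≤ C) →
      (∀ s < 0, MemLp (v s) 6 volume) →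
      (∃ C' : ℝ, 0 ≤ C' ∧ ∀ s < 0, ∀ y, Real.sqrt (-s) * ‖v s y‖ ≤ C') →
      ∀ s < 0, ∀ y, v s y = 0 := by
  intro v hv hsm hens hL6 hclock
  obtain ⟨C', -, hcl⟩ := hclock
  have hT : IsTypeIAncientMild C' v := isTypeIAncientMild_of_typeIClock hv hsm hens hL6 hcl
  exact hA C' v (isTypeIAncientMild_iff.1 hT)

/-- **Item 4050 ⟹ LRL** (drop the enstrophy clock as well). [cite: KochNadirashviliSereginSverak2009, §1] -/
theorem lerayRateLiouville_of_typeIAncientLiouville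
    (hA : Summit.NavierStokesRegularity.NavierStokesRegularity.Theses.ExtremalTypeIConstant.TypeIAncientLiouville) :
    ∀ v : ℝ → EuclideanSpace ℝ (Fin 3) → EuclideanSpace ℝ (Fin 3),
      IsBoundedAncientMildSolution 1 v →
      ContDiffOn ℝ (⊤ : ℕ∞) (Function.uncurry v) (Set.Iio 0 ×ˢ Set.univ) →
      (∃ C : NNReal, ∀ s < 0,
        ∫⁻ y, ENNReal.ofReal (frobeniusNormSq (fderiv ℝ (v s) y)) ≤ C) →
      (∀ s < 0, MemLp (v s) 6 volume) →
      (∃ C' : ℝ, 0 ≤ C' ∧ ∀ s < 0, ∀ y, Real.sqrt (-s) * ‖v s y‖ ≤ C') →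
      (∃ K' : ℝ, 0 ≤ K' ∧ ∀ s < 0, ∫⁻ y, ENNReal.ofReal (frobeniusNormSq (fderiv ℝ (v s) y)) ≤
        ENNReal.ofReal (K' / Real.sqrt (-s))) →
      ∀ s < 0, ∀ y, v s y = 0 :=
  lerayRateLiouville_of_typeIClockLiouville (typeIClockLiouville_of_typeIAncientLiouville hA)

/-- **Route `TypeIQuarterGate` closes from `QuarterLawTypeI ∧ NoTypeII ∧` item 4050, by name**
(`typeIQuarterGate_of_lerayRateLiouville` with `lerayRateLiouville_of_typeIAncientLiouville`): the
Galdi back end X2 ⟨0893⟩ may be traded for the Type-I ancient Liouville target of route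
`ExtremalTypeIConstant`. [cite: KochNadirashviliSereginSverak2009, §1 and §6] -/
theorem typeIQuarterGate_of_typeIAncientLiouville
    (hQ : Summit.NavierStokesRegularity.NavierStokesRegularity.Theses.TypeIQuarterGate.QuarterLawTypeI)
    (hII : Summit.NavierStokesRegularity.NavierStokesRegularity.Theses.TypeIQuarterGate.NoTypeII)
    (hA : Summit.NavierStokesRegularity.NavierStokesRegularity.Theses.ExtremalTypeIConstant.TypeIAncientLiouville) :
    NavierStokesRegularity :=
  typeIQuarterGate_of_lerayRateLiouville hQ hII (lerayRateLiouville_of_typeIAncientLiouville hA)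

end Summit.NavierStokesRegularity.NavierStokesRegularity.Theorems

end
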